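import Summits.FinalStateConjecture.FinalStateConjecture.Theses.SwallowTheDatum
import Summits.FinalStateConjecture.FinalStateConjecture.Theorems.KerrShieldedDataExist.Negative.BentHeight

/-!
# drefute evidence: Stub B (`Sig.stub_collarDatum`) of line `receding-annulus-universal-collar`
# formally contains the open sibling crux `SwallowTheDatum.KerrShieldedDataExist` (stmt-10055).

The two vocabulary predicates and the stub signature are copied VERBATIM from
`Cruxes/ParametricKerrBurial/Lines/receding-annulus-universal-collar.lean` (which is a workfile, not an importable
module); the corollary drops the annulus clause and the shield locator.  Positive lemma ⇒ evidence only
(refuter seat), for the lead's cost bookkeeping (remark R1 of `Negative-notes-stub_collarDatum.md`).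
-/

noncomputable section

set_option linter.dupNamespace false

namespace Summit.FinalStateConjecture.FinalStateConjecture.Cruxes.ParametricKerrBurial.Drefute

open scoped Manifold ContDiff Topology
open Bundle Set Literature.Geometry.Lorentzian
open Summit.FinalStateConjecture.FinalStateConjecture.Theorems.KerrShieldedDataExist.Negative
  (bentHeight bentHeight_eq_literal)

/-- Verbatim copy of `RecedingAnnulusUniversalCollar.IsSchwarzschildAnnulus`. -/
def IsSchwarzschildAnnulus (C : InitialDataSet (𝓡 3) E3) (μ : ℝ) : Prop :=
  ∀ y : E3, 1 < ‖y‖ → ‖y‖ < 2 →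
    C.h.inner y = (1 + μ / (2 * ‖y‖)) ^ 4 • (innerSL ℝ : E3 →L[ℝ] E3 →L[ℝ] ℝ) ∧ C.k y = 0

/-- Verbatim copy of `RecedingAnnulusUniversalCollar.IsKerrShieldedAway`. -/
def IsKerrShieldedAway [Kerr.Facts] (ρ : ℝ) (C : InitialDataSet (𝓡 3) E3) : Prop :=
  ∃ (M a r₁ : ℝ) (hM : 0 ≤ M) (T : ℝ → ℝ) (φ : Kerr.slice a r₁ → E3)
    (ψ : Kerr.slice a r₁ → Kerr.region a r₁) (ν : NormalField 𝓘(ℝ, E4) ψ),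
    (∀ z : Kerr.slice a r₁, ρ < ‖φ z‖) ∧
    |a| < M ∧ Kerr.rMinus M a < r₁ ∧ r₁ < Kerr.rPlus M a ∧ T = bentHeight M a ∧
    IsCompact (Set.range φ)ᶜ ∧ Topology.IsOpenEmbedding φ ∧
    ContMDiff 𝓘(ℝ, E3) (𝓡 3) ∞ φ ∧
    (∀ y : Kerr.slice a r₁, (ψ y : E4) =
      E4.ofTimeSpace (T (Kerr.radius a (E4.ofTimeSpace 0 (y : E3)))) (y : E3)) ∧
    (Kerr.smoothMetric M a r₁).IsSpacelikeImmersion 𝓘(ℝ, E3) ψ ∧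
    (Kerr.smoothMetric M a r₁).IsFutureUnitNormal 𝓘(ℝ, E3)
      ((Kerr.timeOrientation M a r₁ hM).ofLE le_top) ψ ν ∧
    (∀ y : Kerr.slice a r₁,
      pullbackBilin (I := 𝓡 3) (I' := 𝓘(ℝ, E3)) φ C.h.inner y =
        pullbackBilin (I := 𝓘(ℝ, E4)) (I' := 𝓘(ℝ, E3)) ψ (Kerr.smoothMetric M a r₁).val y) ∧
    (∀ [(Kerr.smoothMetric M a r₁).HasLeviCivita] (y : Kerr.slice a r₁),
      (pullbackBilin (I := 𝓡 3) (I' := 𝓘(ℝ, E3)) φ C.k y).toLinearMap₁₂ =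
        (Kerr.smoothMetric M a r₁).secondFundamentalForm 𝓘(ℝ, E3) ψ ν y)

/-- Verbatim copy of `RecedingAnnulusUniversalCollar.Sig.stub_collarDatum`. -/
def Sig.stub_collarDatum : Prop :=
  ∀ [Kerr.Facts], ∀ μ₀ : ℝ, 0 < μ₀ →
    ∃ μ : ℝ, 0 < μ ∧ μ ≤ μ₀ ∧
      ∃ C ∈ admissibleVacuumData E3, IsSchwarzschildAnnulus C μ ∧ IsKerrShieldedAway 2 C

/-- **Stub B ⊇ crux 10055.**  `stub_collarDatum` implies `KerrShieldedDataExist` (drop the Schwarzschild annulus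
and the locator `2 < ‖φ z‖`; the hard-coded height is `bentHeight` by `rfl`). -/
theorem kerrShieldedDataExist_of_stub_collarDatum (hB : Sig.stub_collarDatum) :
    Summit.FinalStateConjecture.FinalStateConjecture.Theses.SwallowTheDatum.KerrShieldedDataExist := by
  intro inst
  obtain ⟨μ, -, -, C, hC, -, M, a, r₁, hM, T, φ, ψ, ν, -, haM, hr₁, hr₂, hT, hK, hemb, hφ, hψ, hsp, hν,
    hh, hk⟩ := hB 1 one_pos
  exact ⟨C, hC, M, a, r₁, hM, T, φ, ψ, ν, haM, hr₁, hr₂, hT, hK, hemb, hφ, hψ, hsp, hν, hh, hk⟩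

end Summit.FinalStateConjecture.FinalStateConjecture.Cruxes.ParametricKerrBurial.Drefute

end
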